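import Literature.Barriers.ValiantsHypothesis.MonotoneGapHamiltonian
import Literature.Barriers.ValiantsHypothesis.MonotoneGapHamiltonianLower
import Literature.Barriers.ValiantsHypothesis.MonotoneGapHamiltonianUpper
import HarnessLib

/-!
# The monotone gap: discharge of `JerrumSnir1982_hamiltonianCircuit` (J. ACM 29 (1982), §4.4)

Sibling of `Literature/Barriers/ValiantsHypothesis/MonotoneGapHamiltonian.lean` (next to
`MonotoneGapPermanentProofs.lean`, which discharges `JerrumSnir1982_permanent`, §4.3) assembling the
proof of the named fact `JerrumSnir1982_hamiltonianCircuit` stated there — Jerrum–Snir's exact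
determination of the monotone `⊗`-complexity of the `n × n` Hamiltonian circuit polynomial,
`(n-1)[(n-2)2^{n-3} + 1]` for `n ≥ 3` — from

* the lower bound `JerrumSnir.le_prodCount_hcPoly` (`MonotoneGapHamiltonianLower.lean`: JS §3,
  Cor. 3.5, i.e. `JerrumSnir.sum_weight_le_prodCount` of `MonotoneGapParseTrees.lean`, with the
  content bound `c(r,d) = (d-1)!(r-d-1)!(n-r-1)!` of §4.4 — proved through the induced cyclic
  permutation `π*` of `MonotoneGapHamiltonianCycles.lean` — and the weight function
  `w(n) = (2^{n-3}(n-2) + 1)/(n-2)!` of `MonotoneGapHamiltonianWeights.lean`);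
* the upper bound `JerrumSnir.exists_isMonotoneComputation_hcPoly`
  (`MonotoneGapHamiltonianUpper.lean`: the Hamiltonian-path dynamic programme of p. 890–891 as a
  plain fan-in-two circuit with exactly `(n-1)(n-2)2^{n-3} + (n-1)` product gates).

## References

* [JerrumSnir1982] M. Jerrum, M. Snir, *Some exact complexity results for straight-line
  computations over semirings*, J. ACM 29 (1982) 874–897, §3 (Thm. 3.2–3.4, Cor. 3.5, Lemma 3.6),
  §4.4 (pp. 889–891).
-/

namespace Literature.Barriers.ValiantsHypothesis

/-- **Jerrum–Snir 1982, §4.4 (discharge of the named fact `JerrumSnir1982_hamiltonianCircuit`).**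
For every `n ≥ 3`, every monotone computation of `HC_{n×n}` over `ℝ≥0` has at least
`(n-1)((n-2)2^{n-3} + 1)` product gates, and the Hamiltonian-path dynamic programme is a monotone
computation with exactly that many: "`⊗`-complexity of
`p ≥ (n-1)![2^{(n-3)}(n-2) + 1]/(n-2)! = (n-1)[(n-2)2^{(n-3)} + 1]`. Again this bound is valid for
`R`, `M`, and `M⁺`, and is attainable … so it can be computed in `(n-1)(n-2)2^{(n-3)} + (n-1)`
multiplications." [cite: JerrumSnir1982, §4.4 (pp. 889–891) and Cor. 3.5] -/
theorem JerrumSnir1982_hamiltonianCircuit_holds : JerrumSnir1982_hamiltonianCircuit := fun _ hn =>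
  ⟨fun _ hP => JerrumSnir.le_prodCount_hcPoly hn hP,
    JerrumSnir.exists_isMonotoneComputation_hcPoly hn⟩

end Literature.Barriers.ValiantsHypothesis
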